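import Summits.NavierStokesRegularity.OSWSelfSimilar.SheetREvenZeroMassCorrection
import HarnessLib

/-!
# SHEET-ℝ frame, EVEN ZERO-MASS class `E⁺₀`: the closed operator `T⁺ = generatorEven` (Kato's `−A⁺_F` on `E⁺₀`) is DENSELY DEFINED —
# even zero-mass `C_c^∞` profiles lie in `D(T⁺)`, and they are dense in `L²_{w,even,0}(ℂ)`

HONEST FRAMING (cell ns-blowup GROUP B / zone Z3, case Z3-SR-SPEC EVEN half, P-list (P9)⁺ «C₀-semigroup generation on the even zero-mass class»: the ONE
hypothesis of the Hille–Yosida theorem for `T⁺ = generatorEven` (selfsim g14 `SheetRResolventEvenClass`: closed ✓, resolvent bound `‖R⁺(σ)‖ ≤ 1/(m + Re σ)` ✓,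
injective ✓) that is not yet in the tree; twin of §4 of profile-cert-5 g7's `SheetRGeneratorOddDense`; 1-D MODEL certificate frame (viscous gCLM/OSW sheet on the
line); not Euler/NS; «violates: none — MODEL»).  Nothing here asserts that a profile exists; the (S1⁺) Gårding datum `h : GardingDataKE …` is the HYPOTHESIS as
everywhere in the even chain (any drift/potential `d, V` with the measurability/growth fields, any bounded `K : EspE →L L²_w`).
CONTENT.
* **`cplxE_jmapE_mem_domain`** — for an even zero-mass `φ ∈ C_c^∞`: `cplxE (jmapE (φ, φ′)) ∈ D(T⁺)` (via selfsim's `mem_domain_of_weakE`; weak image = the even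
  zero-mass correction (`SheetREvenZeroMassCorrection`) of `−φ″ + dφ′ + Vφ + K(jmapE φ)`, which lies in `WevenZ` and pairs with zero-mass even tests like the
  classical image);
* **`dense_domain_generatorEven`** — `Dense (D(T⁺))` in `WcevenZ hL` (orthogonal complement `= ⊥` by the smooth density lemma `eq_zero_of_mem_WevenZ_smooth`).
No definition, no named fact.  WHAT THIS IS NOT: not NS; not a semigroup; no number of record moves.
-/

noncomputable section

namespace Summit.NavierStokesRegularity.OSWSelfSimilar
namespace SheetRGeneratorEvenDense


open _root_.MeasureTheory _root_.Set _root_.Filter _root_.Real Literature.Analysis.Fourier SheetRWeakProfilePV SheetRWeakToStrong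
  SheetREnergyClass SheetRWeightedMeasure SheetREnergySpace SheetRLinearisedTests SheetRTestSpace SheetRLinearisedFormBounds
  SheetRComplexPivot SheetROddClass SheetREvenTests SheetREvenEnergySpace SheetREvenForms SheetREvenPairUniqueness
  SheetREvenClass SheetRResolventEvenClass SheetRGeneratorEvenWeak SheetREvenEnergySpaceOf SheetRGeneratorOddDense SheetREvenZeroMassCorrection SheetRWeakEigenReal
  SheetRSpectrumOddAssemblyReal Literature.Analysis.OperatorTheory Complex
open scoped Topology ENNReal InnerProductSpace ContDiff

variable {L : ℝ} {d V : ℝ → ℝ} {D₀ D₁ V₀ c m : ℝ}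

/-! ### §1 Even zero-mass smooth compactly supported profiles lie in `D(T⁺)`; `D(T⁺)` is dense -/

/-- **Even zero-mass smooth compactly supported profiles lie in `D(T⁺)`.**  For an even `φ ∈ C_c^∞` with `∫φ = 0` and its energy-space element
`p = jmapE (φ, φ′)`: the complex class `cplxE p = ιEE p + 0i ∈ WcevenZ` lies in the domain of `generatorEven` — its weak image is the even zero-mass correction of
`−φ″ + dφ′ + Vφ + K p ∈ L²_w` (selfsim's `mem_domain_of_weakE`). [folklore] -/
theorem cplxE_jmapE_mem_domain (hL : 0 < L) (K : EspE L hL →L[ℝ] W L) (h : GardingDataKE L hL d V K D₀ D₁ V₀ c m) {σ₀ : ℂ} (hσ₀ : -m < σ₀.re)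
    {φ : ℝ → ℝ} (hφ : ContDiff ℝ ∞ φ) (hφc : HasCompactSupport φ) (heven : ∀ y, φ (-y) = φ y) (h0 : ∫ y, φ y = 0) :
    cplxE hL (jmapE hL ⟨(φ, deriv φ), isCompactTestE_of_smooth_even hφ hφc heven, h0⟩) ∈ (generatorEven hL K h σ₀ hσ₀).domain := by
  set vp : testSpaceE0 := ⟨(φ, deriv φ), isCompactTestE_of_smooth_even hφ hφc heven, h0⟩ with hvp
  set p : EspE L hL := jmapE hL vp with hpdef
  have hφ2 : ContDiff ℝ 2 φ := hφ.of_le (WithTop.coe_le_coe.2 le_top)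
  obtain ⟨hdm, hVm, hd, hV⟩ : AEStronglyMeasurable d volume ∧ AEStronglyMeasurable V volume ∧ (∀ ξ, |d ξ| ≤ D₀ + D₁ * |ξ|) ∧ ∀ ξ, |V ξ| ≤ V₀ :=
    ⟨h.d_meas, h.V_meas, h.d_le, h.V_le⟩
  have hq := memLp_local_smooth (L := L) hdm hVm h.D₀_nonneg h.D₁_nonneg hd hV hφ2 hφc
  set g : W L := hq.toLp _ + K p with hgdef
  set ρ : W L := (memLp_invWeight hL).toLp _ with hρdef
  have hρ : (ρ : ℝ → ℝ) =ᵐ[volume] fun y => (L ^ 2 + y ^ 2)⁻¹ := ae_volume_of_ae_μw hL (MemLp.coeFn_toLp _)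
  set FR : W L := (1 / 2 : ℝ) • (g + reflW L g) - (L / π * massW hL ((1 / 2 : ℝ) • (g + reflW L g))) • ρ with hFRdef
  have hFR : FR ∈ WevenZ hL := evenZ_correction_mem hL g hρ
  refine (mem_domain_of_weakE hL K h hσ₀ (u := cplxE hL p) (F := realE hL FR hFR) (P := WithLp.toLp 2 (p, (0 : EspE L hL))) (coe_cplxE hL p).2 ?_).1
  -- the weak image identity on zero-mass even tests
  obtain ⟨hae, -, hprof⟩ := jmapE_snd_ae hL vp
  have hre : reW L (realE hL FR hFR : Wc L) = FR := by rw [coe_realE]; exact (reW_imW_ofRealW (L := L) FR).1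
  have him : imW L (realE hL FR hFR : Wc L) = 0 := by rw [coe_realE]; exact (reW_imW_ofRealW (L := L) FR).2
  intro v v₁ hv hv0
  have hfst : (WithLp.toLp 2 (p, (0 : EspE L hL))).fst = p := rfl
  have hsnd : (WithLp.toLp 2 (p, (0 : EspE L hL))).snd = 0 := rfl
  set wq : testSpaceE0 := ⟨(v, v₁), hv, hv0⟩ with hwq
  rw [hfst, hsnd, hre, him]
  refine ⟨?_, ?_⟩
  · -- first component: linForm(φ) + ∫ w (K p) v = ∫ w FR v = ∫ w g v = ∫ w q v + ∫ w (K p) v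
    have hlinp : linForm L d V (profile p) (derE p) v v₁ = linForm L d V φ (deriv φ) v v₁ :=
      linForm_congr_ae L d V (Eventually.of_forall fun y => by rw [hpdef, hprof]) (by rw [derE_def, hpdef]; exact hae)
    rw [hlinp, linForm_smooth_eq_integral_any hL hdm hVm h.D₀_nonneg h.D₁_nonneg hd hV hφ2 hφc hv.toIsCompactTestAny, hFRdef,
      integral_weight_correction_mul_test hL g hρ hv hv0, hgdef, ← PdataE_apply hL (hq.toLp _ + K p) wq, map_add (PdataE hL),
      LinearMap.add_apply, PdataE_apply hL _ wq, PdataE_apply hL _ wq]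
    show (∫ y, (L ^ 2 + y ^ 2) * ((-deriv (deriv φ) y + d y * deriv φ y + V y * φ y) * v y)) + _ =
      (∫ y, (L ^ 2 + y ^ 2) * (((hq.toLp _ : W L) : ℝ → ℝ) y * v y)) + _
    congr 1
    refine integral_congr_ae ?_
    filter_upwards [ae_volume_of_ae_μw hL (MemLp.coeFn_toLp hq)] with y hy
    rw [hy]
  · -- second component: everything vanishes
    have hz : linForm L d V (profile (0 : EspE L hL)) (derE (0 : EspE L hL)) v v₁ = 0 := by
      have e := (EformE_apply hL hdm hVm h.D₁_nonneg hd hV (0 : EspE L hL) wq).symm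
      rw [map_zero, LinearMap.zero_apply] at e
      exact e
    rw [hz, map_zero, ← PdataE_apply hL (0 : W L) wq, map_zero, LinearMap.zero_apply]
    simp

/-- **`D(T⁺)` IS DENSE in `L²_{w,even,0}(ℂ)`.**  The orthogonal complement of the domain of `generatorEven` inside the Hilbert space `WcevenZ hL` is trivial:
a `G ⊥ D(T⁺)` pairs to zero with `φ + 0i` for every even zero-mass `φ ∈ C_c^∞`, so `Re G` and `Im G` vanish by the smooth density lemma.  (The remaining
Hille–Yosida hypothesis for (P9)⁺.) [folklore] -/
theorem dense_domain_generatorEven (hL : 0 < L) (K : EspE L hL →L[ℝ] W L) (h : GardingDataKE L hL d V K D₀ D₁ V₀ c m) {σ₀ : ℂ} (hσ₀ : -m < σ₀.re) :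
    Dense ((generatorEven hL K h σ₀ hσ₀).domain : Set (WcevenZ hL)) := by
  haveI : CompleteSpace (WcevenZ hL) := completeSpace_WcevenZ hL
  rw [Submodule.dense_iff_topologicalClosure_eq_top, Submodule.topologicalClosure_eq_top_iff, Submodule.eq_bot_iff]
  intro G hG
  rw [Submodule.mem_orthogonal'] at hG
  obtain ⟨hGR, hGI⟩ := (mem_WcevenZ_iff hL (G : Wc L)).1 G.2
  have hpair : ∀ φ : ℝ → ℝ, ContDiff ℝ ∞ φ → HasCompactSupport φ → (∀ y, φ (-y) = φ y) → ∫ y, φ y = 0 →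
      (∫ y, (L ^ 2 + y ^ 2) * (((reW L (G : Wc L) : W L) : ℝ → ℝ) y * φ y) = 0) ∧
        ∫ y, (L ^ 2 + y ^ 2) * (((imW L (G : Wc L) : W L) : ℝ → ℝ) y * φ y) = 0 := by
    intro φ hφ hφc heven h0
    set p : EspE L hL := jmapE hL ⟨(φ, deriv φ), isCompactTestE_of_smooth_even hφ hφc heven, h0⟩ with hpdef
    have hmem := cplxE_jmapE_mem_domain hL K h hσ₀ hφ hφc heven h0
    have h0' := hG _ hmem
    rw [Submodule.coe_inner, (coe_cplxE hL p).1] at h0'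
    -- `⟪G, ιEE p + 0i⟫ = ⟪Re G, ιEE p⟫ − i⟪Im G, ιEE p⟫`
    have hsplit : (G : Wc L) = ofRealW L (reW L (G : Wc L)) + (Complex.I : ℂ) • ofRealW L (imW L (G : Wc L)) := by
      conv_lhs => rw [← ofPair_toPair (G : Wc L)]
      rw [ofPair_apply, (toPair_fst_snd _).1, (toPair_fst_snd _).2]
    rw [hsplit, inner_add_left, inner_smul_left, inner_ofRealW, inner_ofRealW, Complex.conj_I] at h0'
    have hre := congrArg Complex.re h0'
    have him := congrArg Complex.im h0'
    simp only [Complex.add_re, Complex.add_im, Complex.mul_re, Complex.mul_im, Complex.neg_re, Complex.neg_im, Complex.I_re, Complex.I_im,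
      Complex.ofReal_re, Complex.ofReal_im, Complex.zero_re, Complex.zero_im] at hre him
    -- real inner products as weighted integrals
    have hι : ((ιEE hL p : W L) : ℝ → ℝ) =ᵐ[volume] φ := by
      have h1 := ιEE_ae hL p
      rw [hpdef, (jmapE_snd_ae hL _).2.2] at h1
      exact h1
    have hinner : ∀ gR : W L, ⟪gR, ιEE hL p⟫_ℝ = ∫ y, (L ^ 2 + y ^ 2) * ((gR : ℝ → ℝ) y * φ y) := by
      intro gR
      rw [L2.inner_def]
      have key : ∫ a, ⟪((gR : W L) : ℝ → ℝ) a, ((ιEE hL p : W L) : ℝ → ℝ) a⟫_ℝ ∂(μw L) =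
          ∫ y, (L ^ 2 + y ^ 2) * ⟪((gR : W L) : ℝ → ℝ) y, ((ιEE hL p : W L) : ℝ → ℝ) y⟫_ℝ :=
        integral_withDensity_weight L _
      rw [key]
      refine integral_congr_ae ?_
      filter_upwards [hι] with y hy
      rw [RCLike.inner_apply, conj_trivial, hy]; ring
    simp only [hinner, neg_zero, zero_mul, mul_zero, sub_zero, zero_add, add_zero, neg_mul, one_mul] at hre him
    constructor
    · linarith
    · linarith
  have hR0 : reW L (G : Wc L) = 0 := eq_zero_of_mem_WevenZ_smooth hL hGR fun φ hφ hφc he h0 => (hpair φ hφ hφc he h0).1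
  have hI0 : imW L (G : Wc L) = 0 := eq_zero_of_mem_WevenZ_smooth hL hGI fun φ hφ hφc he h0 => (hpair φ hφ hφc he h0).2
  apply Subtype.ext
  rw [Submodule.coe_zero, ← ofPair_toPair (G : Wc L)]
  have h1 : (toPair L (G : Wc L)).fst = (0 : WithLp 2 (W L × W L)).fst := by rw [(toPair_fst_snd _).1, hR0, WithLp.zero_fst]
  have h2 : (toPair L (G : Wc L)).snd = (0 : WithLp 2 (W L × W L)).snd := by rw [(toPair_fst_snd _).2, hI0, WithLp.zero_snd]
  have : toPair L (G : Wc L) = 0 := WithLp.ofLp_injective 2 (Prod.ext h1 h2)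
  rw [this, map_zero]

end SheetRGeneratorEvenDense
end Summit.NavierStokesRegularity.OSWSelfSimilar

end
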